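import Literature.AnabelianGeometry.EtaleTheta.Discharge.Sec4NonVacuity
import HarnessLib

/-!
# [EtTh] Def. 4.1 (i), ERRATUM E2 approach (B), condition (d) `FractionPair.CondD` — the SCHEMA half
# (FACT-LIST row F-1919): the bare universal closure is FALSE in the kernel

Source: [MochizukiEtTh2009] §4, Definition 4.1 (i), PDF p.86 (printed 312), with [IUTchI] Remark 3.2.4 (iv)(B)
(kurims p.76): condition (d) on `f ∈ O^×(A^birat)` — «for every `N ∈ ℕ_{≥1}`, there exists a linear morphism
`A' → A` in `C` such that the pull-back of `f` to `A'` admits an `N`-th root».  In the tree this is the predicate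
`BiKummerSetting.FractionPair.CondD (S) (A) (f) (pull)` of `BiKummer.lean` (abc-iut-L2-t3, p407563), a CONDITION on
the datum `f` (and on the `Aut`-free transport datum `pull`), recorded for approach (B); IUT itself uses approach (A).

PROOF-ONLY companion (cell abc-iut, block F / D-0079 L-F [EtTh]; FACT-LIST row F-1919, LF-KERNEL-STATUS 15:07Z «LABEL-OPEN,
genuine open debt as typed»).  What this file settles, and ONLY this:

* `ToyCondD.not_forall_condD` — the BARE UNIVERSAL CLOSURE of the row (every base field, every `Π^tp_X`, every
  Def. 3.6 (i) datum, every setting `S`, every object `A`, every `f`, every transport `pull`) is FALSE: the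
  birational-unit vocabulary of `BiKummerSetting` (`biratUnits`, `biratAut`, `restrictAlong`, `fracOf`) is law-free
  DATA ([FrdI] Prop. 4.4 is TODO-merge(abc-iut-L1-t3) there), so over the landed perfect toy setting
  `Toy.biKummerSetting` (abc-iut-w5-d013, `Discharge/Sec4NonVacuity.lean`) one may take `O^×(A^birat) := ℤˣ = {±1}`
  at every object and the constant transport `pull := -1`; then `g² = 1 ≠ -1` for every `g ∈ ℤˣ`, so condition (d)
  fails at `N = 2` (witness assembled inside the proof of `ToyCondD.not_forall_condD`; the file declares NO definition).  Degenerate arithmetic; a consistency/independence witness about OUR typed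
  interface, nothing more.
* The INSTANCE FORMS that print actually uses are the theorems of record, consumed BY NAME and not restated here:
  `BiKummerSetting.Prop42Sub.condD_Aodot_of_rootOverCovering` (approach (A)'s output ⇒ (d) at `A_⊙`),
  `…condD_mkOfModelCanonical_of_ratFnRootLaw` / `…_of_baseRootLaw` / `…_of_dataRootLaw` (condition (d) at every
  `IG`-object of the canonical model from the printed root laws) — file `Discharge/Sec4CondDOfRootLaw.lean`.

So the row reads, for the FACT-LIST fold: «∀-closure REFUTED (schema); instance forms PROVED at the canonical
models under the printed root law».  HONEST LABEL: the toy is NOT a model of any curve; no side is taken on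
[IUTchIII] Cor. 3.12 or on either erratum approach; typed ≠ proved ≠ endorsed.
-/

namespace Literature.AnabelianGeometry.EtaleTheta

open CategoryTheory Opposite Literature.AlgebraicGeometry.Frobenioids

namespace ToyCondD

/-- In `ℤˣ` no element squares to `-1` (every unit of `ℤ` squares to `1`). [folklore] -/
private theorem units_int_sq_ne_neg_one (g : ℤˣ) : g ^ 2 ≠ -1 := by
  rw [Int.units_sq]
  decide

/-- **F-1919, SCHEMA half — the bare universal closure of `BiKummerSetting.FractionPair.CondD` is FALSE**
(universe `0`, every binder explicit: base field `K`, `Π^tp_X`, the Def. 3.6 (i) datum `T`, the base category `D`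
with its [FrdI] vocabulary `VD`, the setting `S`, the object `A`, the birational unit `f`, the transport `pull`).
WITNESS (built inside the proof, no new definition): abc-iut-w5-d013's perfect toy `Toy.biKummerSetting`
(canonical model over the one-object base, `Φ = ℚ_{≥0}`; `Discharge/Sec4NonVacuity.lean`) with its LAW-FREE
birational-unit vocabulary replaced by `O^×(A^birat) := ℤˣ = {±1}` at every object (trivial `Aut_C(A)`-action,
`restrictAlong := id`, `fracOf := 1`; every other field verbatim), the object `A := A_⊙`, `f := 1`, and the constant
transport `pull := -1`: condition (d) at `N = 2` would give `g ∈ ℤˣ` with `g² = -1`, but `g² = 1`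
(`units_int_sq_ne_neg_one`).  Degenerate arithmetic — a consistency/independence witness about OUR typed interface
(the [FrdI] Prop. 4.4 laws of `O^×(A^birat)` are TODO-merge(abc-iut-L1-t3) in `BiKummerSetting`), nothing more.
The instance forms used in print are the theorems `BiKummerSetting.Prop42Sub.condD_Aodot_of_rootOverCovering` /
`…condD_mkOfModelCanonical_of_ratFnRootLaw` / `…_of_baseRootLaw` / `…_of_dataRootLaw`
(`Discharge/Sec4CondDOfRootLaw.lean`), consumed by name. [cite: MochizukiEtTh2009, Def 4.1 (i) p.86] -/
theorem not_forall_condD :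
    ¬ ∀ {K : Type} [Field K] {X : SemiGraphs.TemperedArithmeticGroup.{0} K} {D₀ : Type} [Category.{0} D₀]
        {V : FrdIMonoidStub.{0}} {T : RealifiedDivisorMonoids (D₀ := D₀) V} {D : Type} [Category.{0} D]
        {VD : FrdICatStub.{0, 0, 0} D} (S : BiKummerSetting X T D VD) (A : S.C) (f : S.biratUnits A)
        (pull : ∀ {A' : S.C} (_ : A' ⟶ A), S.biratUnits A → S.biratUnits A'),
        BiKummerSetting.FractionPair.CondD (S := S) (A := A) (f := f) pull := by
  intro h
  -- the separating setting: the perfect toy with `O^×(A^birat) := ℤˣ` (law-free vocabulary fields only)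
  let S' : BiKummerSetting Toy.temperedGroup Toy.realifiedQ (Discrete PUnit.{1}) Toy.catVocab :=
    { Toy.biKummerSetting with
      biratUnits := fun _ => ℤˣ
      instBirat := fun _ => inferInstance
      biratAut := fun _ => 1
      restrictAlong := fun _ _ => MulEquiv.refl _
      fracOf := fun _ _ _ _ _ => 1 }
  -- condition (d) at `A_⊙`, `f = 1`, `pull = -1`, `N = 2`
  obtain ⟨A', φ, -, g, hg⟩ :=
    h S' S'.Aodot 1 (fun {A'} _ _ => show S'.biratUnits A' from (-1 : ℤˣ)) 2
  have hg' : (id g : ℤˣ) ^ 2 = -1 := hg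
  exact units_int_sq_ne_neg_one _ hg'

end ToyCondD

end Literature.AnabelianGeometry.EtaleTheta
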